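import Summits.CriticalPhenomena.PercolationContinuityZ3.Theorems.Transplant.PlanarSkeletonFrmFromDefs
import Summits.CriticalPhenomena.PercolationContinuityZ3.Theorems.Transplant.SkelFrmFromBChoiceNums
import Summits.CriticalPhenomena.PercolationContinuityZ3.Theorems.Transplant.SkelFrmBChoiceNums
import Summits.CriticalPhenomena.PercolationContinuityZ3.Theorems.Transplant.SkelFrmFromBParamsFaceBandA2
import Summits.CriticalPhenomena.PercolationContinuityZ3.Theorems.Transplant.SkelFrmBParamsFaceBandA2
import HarnessLib
import Summits.CriticalPhenomena.PercolationContinuityZ3.Theorems.Transplant.SkelFrmBParamsFaceBandA2R0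
/-!
# U-WAVE PORT (RULING D-U, lead g21 2026-08-26; WAVE-U-MANIFEST v3.1 row «SkelFrmBParamsFaceBandA2R0» ↦ «SkelFrmFromBParamsFaceBandA2R0») of the tree module
# `Transplant/SkelFrmBParamsFaceBandA2R0` onto the carrier `PlanarSkeletonFrmFrom` (frames only, cylinders connected from width `ℓ₀` on)

ORIGINAL TITLE: N2 (frames-only node `SamePDropOfSkeletonFrmFrom₁`, OPEN) params column over `PlanarSkeletonFrm` — (F) value layer, **J19 / R0 SUCCESSOR of

builds on p205010 (kernel theorem, internal audit signed; external expert review pending) — nothing in this file uses p205010; NOTHING is claimed about the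
OPEN node U `SamePDropOfSkeletonFrmFrom₁` (nor U_s / the end state).  Lane `prim-bschramm`, seat `prim-bschramm-stmt` gen 26 (port pen, RULING M-11 family P-stmt; tool = p3-g26's port_u.py of record, registry-driven inputs); helper file
(`--supports stmt-CriticalPhenomena-4575 --as helper`).  PORT RULES r1–r4 of RULING D-U: declaration order and proof texts are those of the original,
byte-identical except (i) the carrier token `PlanarSkeletonFrm ↦ PlanarSkeletonFrmFrom` (binders, `namespace`/`end` lines, qualified names of twinned
declarations), (ii) carrier-FREE declarations of the original (φ-level `Skelφ…` blocks and namespace-only arithmetic residents) are NOT re-declared —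
this file imports the original and `export`s the twin-free residents (POLICY T / treatment (m1)); residents whose statement mentions a twinned
constant are copied, (iii) every carrier-binding declaration keeps its explicit binder `(Φ : PlanarSkeletonFrmFrom G)` in its own signature (r2).  Docstrings and citations are the original's.
-/

noncomputable section

open scoped Classical

namespace Summit.CriticalPhenomena.PercolationContinuityZ3.Theorems.Transplant

namespace PlanarSkeletonFrmFrom

namespace NegB

open Literature.Probability.Percolation Literature.Probability.LatticeModels SimpleGraph
open Literature.Probability.Percolation.KozmaNitzan.Cells (oth)
open SkelConc (Consts)
open Skelφ.StepI (DataN)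
open Neg

section Band2

/-- **THE CONTACT BAND ROOMS AT `Rl ≤ 2·R'0`** (`g := gT`, both axes, `u_JA = s_J`), under the stride floor `huR0 : 6·R'0 + 11 ≤ u_JA`:
`kFF₂ + 8·u_JA + 9 ≤ 5·r_J` and `2·kFF₂ + 8·u_JA + 8 ≤ 5·r_J` (from `kFF₂ ≤ 2r + 5Rl + 15`, `10·R'0 < 2·u_JA`, `40·u_JA ≤ r_J`) — the R′0 successor of `hkE_RA2`.
[cite: KozmaNitzan2024, §4 Lemma 12 (pp. 23–25)] -/
theorem hkE_R02 (κ : Consts) {V : Type} [DecidableEq V] [Countable V] {G : SimpleGraph V} [G.LocallyFinite] (Φ : PlanarSkeletonFrmFrom G) (t : V) (p : unitInterval) (D : Skelφ.StepI.DataNS V) (f : ℕ) (mk : ℕ) (gx : Neg.FSlot) (hN : EqNumL κ Φ t p D (KS.gT mk gx κ Φ t p D) f) (hκ : (hL κ Φ t p D (KS.gT mk gx κ Φ t p D) f).natAbs ≤ 10 * nL κ Φ t p D (KS.gT mk gx κ Φ t p D) f)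
    {Rl : ℕ} (hRl : Rl ≤ 2 * KS0.R'0 κ Φ t p D mk) (I : Fin 2)
    (huR0 : 6 * (KS0.R'0 κ Φ t p D mk : ℤ) + 11 ≤ (if oth I = 0 then KS.u₀A κ Φ t p D (KS.gT mk gx κ Φ t p D) f else KS.u₁A κ Φ t p D (KS.gT mk gx κ Φ t p D) f)) :
    (prFA κ Φ t p D (KS.gT mk gx κ Φ t p D) f).kFF₂ (fcellsA κ Φ t p D (KS.gT mk gx κ Φ t p D) f) Rl I +
          8 * (if oth I = 0 then KS.u₀A κ Φ t p D (KS.gT mk gx κ Φ t p D) f else KS.u₁A κ Φ t p D (KS.gT mk gx κ Φ t p D) f) + 9 ≤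
        5 * ((fcellsA κ Φ t p D (KS.gT mk gx κ Φ t p D) f).r (oth I) : ℤ) ∧
      2 * (prFA κ Φ t p D (KS.gT mk gx κ Φ t p D) f).kFF₂ (fcellsA κ Φ t p D (KS.gT mk gx κ Φ t p D) f) Rl I +
          8 * (if oth I = 0 then KS.u₀A κ Φ t p D (KS.gT mk gx κ Φ t p D) f else KS.u₁A κ Φ t p D (KS.gT mk gx κ Φ t p D) f) + 8 ≤
        5 * ((fcellsA κ Φ t p D (KS.gT mk gx κ Φ t p D) f).r (oth I) : ℤ) := by
  have hq := kFF₂_le_linA κ Φ t p D f mk gx hN hκ Rl I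
  obtain ⟨-, -, hru⟩ := uA_oth_facts κ Φ t p D f mk gx hN hκ I
  have hu := huR0
  have hRl' : (Rl : ℤ) ≤ 2 * KS0.R'0 κ Φ t p D mk := by exact_mod_cast hRl
  have hR0 : (0 : ℤ) ≤ (Rl : ℤ) := Nat.cast_nonneg _
  set q := (prFA κ Φ t p D (KS.gT mk gx κ Φ t p D) f).kFF₂ (fcellsA κ Φ t p D (KS.gT mk gx κ Φ t p D) f) Rl I
  set u := (if oth I = 0 then KS.u₀A κ Φ t p D (KS.gT mk gx κ Φ t p D) f else KS.u₁A κ Φ t p D (KS.gT mk gx κ Φ t p D) f)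
  set r := ((fcellsA κ Φ t p D (KS.gT mk gx κ Φ t p D) f).r (oth I) : ℤ)
  constructor <;> linarith

/-- **The (S0) kit's band reach is at most `2·R'0`**: `Rlev0 + reach0 − 1 ≤ 2·R'0` (`R'0 = Rlev0 + 1`, `Rlev0 = j₁0 + reach0 ≥ reach0`) — the R′0 successor of
`apronRl_le`. [folklore] -/
theorem kit0Rl_le (κ : Consts) {V : Type} [DecidableEq V] [Countable V] {G : SimpleGraph V} [G.LocallyFinite] (Φ : PlanarSkeletonFrmFrom G) (t : V) (p : unitInterval) (D : Skelφ.StepI.DataNS V) (mk : ℕ) :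
    KS0.Rlev0 κ Φ t p D mk + KS0.reach0 t D mk - 1 ≤ 2 * KS0.R'0 κ Φ t p D mk := by
  have h := KS0.R'0_eq κ Φ t p D mk
  unfold KS0.Rlev0 at h ⊢
  omega

/-- **THE CONTACT BAND ROOMS AT THE KEYSTONE's `kE`-REACH** (`Rl := Rlev0 + reach0 − 1`, hp-8's `kE := kFF₂ … (E − 1) du.1`, `E := Rlev0 + reach0`), under `huR0`:
`kFF₂ + 8·u_JA + 9 ≤ 5·r_J` and `2·kFF₂ + 8·u_JA + 8 ≤ 5·r_J` — the R′0 successor of `hkE_apron_RA`. [cite: KozmaNitzan2024, §4 Lemma 12 (pp. 23–25)] -/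
theorem hkE_kit0_R0 (κ : Consts) {V : Type} [DecidableEq V] [Countable V] {G : SimpleGraph V} [G.LocallyFinite] (Φ : PlanarSkeletonFrmFrom G) (t : V) (p : unitInterval) (D : Skelφ.StepI.DataNS V) (f : ℕ) (mk : ℕ) (gx : Neg.FSlot) (hN : EqNumL κ Φ t p D (KS.gT mk gx κ Φ t p D) f) (hκ : (hL κ Φ t p D (KS.gT mk gx κ Φ t p D) f).natAbs ≤ 10 * nL κ Φ t p D (KS.gT mk gx κ Φ t p D) f)
    (I : Fin 2)
    (huR0 : 6 * (KS0.R'0 κ Φ t p D mk : ℤ) + 11 ≤ (if oth I = 0 then KS.u₀A κ Φ t p D (KS.gT mk gx κ Φ t p D) f else KS.u₁A κ Φ t p D (KS.gT mk gx κ Φ t p D) f)) :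
    (prFA κ Φ t p D (KS.gT mk gx κ Φ t p D) f).kFF₂ (fcellsA κ Φ t p D (KS.gT mk gx κ Φ t p D) f) (KS0.Rlev0 κ Φ t p D mk + KS0.reach0 t D mk - 1) I +
          8 * (if oth I = 0 then KS.u₀A κ Φ t p D (KS.gT mk gx κ Φ t p D) f else KS.u₁A κ Φ t p D (KS.gT mk gx κ Φ t p D) f) + 9 ≤
        5 * ((fcellsA κ Φ t p D (KS.gT mk gx κ Φ t p D) f).r (oth I) : ℤ) ∧
      2 * (prFA κ Φ t p D (KS.gT mk gx κ Φ t p D) f).kFF₂ (fcellsA κ Φ t p D (KS.gT mk gx κ Φ t p D) f) (KS0.Rlev0 κ Φ t p D mk + KS0.reach0 t D mk - 1) I +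
          8 * (if oth I = 0 then KS.u₀A κ Φ t p D (KS.gT mk gx κ Φ t p D) f else KS.u₁A κ Φ t p D (KS.gT mk gx κ Φ t p D) f) + 8 ≤
        5 * ((fcellsA κ Φ t p D (KS.gT mk gx κ Φ t p D) f).r (oth I) : ℤ) :=
  hkE_R02 κ Φ t p D f mk gx hN hκ (kit0Rl_le κ Φ t p D mk) I huR0

/-! ### The `4·r⊥` rows for the creep-aware habitat of (R-40) (hp-8 g42 08:54:57Z) -/

/-- **`kFF₂ + 8·u + 8 ≤ 4·r_(oth I)` for every `Rl ≤ 2·R'0`**, under `huR0` — serves hp-8's creep-aware row `kE + 8u + 8 + P.c i ≤ 5·r⊥` with the per-axis cap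
`P.c i ≤ r⊥` (room: `kFF₂ ≤ 2r + 10R'0 + 15`, `10R'0 < 2u`, `2r ≥ 80u`). [cite: KozmaNitzan2024, §4 Lemma 12 (pp. 23–25)] -/
theorem hkE8_R0₄ (κ : Consts) {V : Type} [DecidableEq V] [Countable V] {G : SimpleGraph V} [G.LocallyFinite] (Φ : PlanarSkeletonFrmFrom G) (t : V) (p : unitInterval) (D : Skelφ.StepI.DataNS V) (f : ℕ) (mk : ℕ) (gx : Neg.FSlot) (hN : EqNumL κ Φ t p D (KS.gT mk gx κ Φ t p D) f) (hκ : (hL κ Φ t p D (KS.gT mk gx κ Φ t p D) f).natAbs ≤ 10 * nL κ Φ t p D (KS.gT mk gx κ Φ t p D) f)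
    {Rl : ℕ} (hRl : Rl ≤ 2 * KS0.R'0 κ Φ t p D mk) (I : Fin 2)
    (huR0 : 6 * (KS0.R'0 κ Φ t p D mk : ℤ) + 11 ≤ (if oth I = 0 then KS.u₀A κ Φ t p D (KS.gT mk gx κ Φ t p D) f else KS.u₁A κ Φ t p D (KS.gT mk gx κ Φ t p D) f)) :
    (prFA κ Φ t p D (KS.gT mk gx κ Φ t p D) f).kFF₂ (fcellsA κ Φ t p D (KS.gT mk gx κ Φ t p D) f) Rl I +
        8 * (if oth I = 0 then KS.u₀A κ Φ t p D (KS.gT mk gx κ Φ t p D) f else KS.u₁A κ Φ t p D (KS.gT mk gx κ Φ t p D) f) + 8 ≤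
      4 * ((fcellsA κ Φ t p D (KS.gT mk gx κ Φ t p D) f).r (oth I) : ℤ) := by
  have hq := kFF₂_le_linA κ Φ t p D f mk gx hN hκ Rl I
  obtain ⟨-, -, hru⟩ := uA_oth_facts κ Φ t p D f mk gx hN hκ I
  have hu := huR0
  have hRl' : (Rl : ℤ) ≤ 2 * KS0.R'0 κ Φ t p D mk := by exact_mod_cast hRl
  have hR0 : (0 : ℤ) ≤ (Rl : ℤ) := Nat.cast_nonneg _
  have hR : (0 : ℤ) ≤ (KS0.R'0 κ Φ t p D mk : ℤ) := Nat.cast_nonneg _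
  set q := (prFA κ Φ t p D (KS.gT mk gx κ Φ t p D) f).kFF₂ (fcellsA κ Φ t p D (KS.gT mk gx κ Φ t p D) f) Rl I
  set u := (if oth I = 0 then KS.u₀A κ Φ t p D (KS.gT mk gx κ Φ t p D) f else KS.u₁A κ Φ t p D (KS.gT mk gx κ Φ t p D) f)
  set r := ((fcellsA κ Φ t p D (KS.gT mk gx κ Φ t p D) f).r (oth I) : ℤ)
  linarith

/-- **`kFF₂ + 24·u + 24 ≤ 4·r_(oth I)` for every `Rl ≤ 2·R'0`**, under `huR0` — the `24u` twin (tangential rows) for the creep-aware habitat with `P.c i ≤ r⊥`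
(room: `2r ≥ 80u ≥ 26u + 39`). [cite: KozmaNitzan2024, §4 Lemma 12 (pp. 23–25)] -/
theorem hkE24_R0₄ (κ : Consts) {V : Type} [DecidableEq V] [Countable V] {G : SimpleGraph V} [G.LocallyFinite] (Φ : PlanarSkeletonFrmFrom G) (t : V) (p : unitInterval) (D : Skelφ.StepI.DataNS V) (f : ℕ) (mk : ℕ) (gx : Neg.FSlot) (hN : EqNumL κ Φ t p D (KS.gT mk gx κ Φ t p D) f) (hκ : (hL κ Φ t p D (KS.gT mk gx κ Φ t p D) f).natAbs ≤ 10 * nL κ Φ t p D (KS.gT mk gx κ Φ t p D) f)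
    {Rl : ℕ} (hRl : Rl ≤ 2 * KS0.R'0 κ Φ t p D mk) (I : Fin 2)
    (huR0 : 6 * (KS0.R'0 κ Φ t p D mk : ℤ) + 11 ≤ (if oth I = 0 then KS.u₀A κ Φ t p D (KS.gT mk gx κ Φ t p D) f else KS.u₁A κ Φ t p D (KS.gT mk gx κ Φ t p D) f)) :
    (prFA κ Φ t p D (KS.gT mk gx κ Φ t p D) f).kFF₂ (fcellsA κ Φ t p D (KS.gT mk gx κ Φ t p D) f) Rl I +
        24 * (if oth I = 0 then KS.u₀A κ Φ t p D (KS.gT mk gx κ Φ t p D) f else KS.u₁A κ Φ t p D (KS.gT mk gx κ Φ t p D) f) + 24 ≤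
      4 * ((fcellsA κ Φ t p D (KS.gT mk gx κ Φ t p D) f).r (oth I) : ℤ) := by
  have hq := kFF₂_le_linA κ Φ t p D f mk gx hN hκ Rl I
  obtain ⟨-, -, hru⟩ := uA_oth_facts κ Φ t p D f mk gx hN hκ I
  have hu := huR0
  have hRl' : (Rl : ℤ) ≤ 2 * KS0.R'0 κ Φ t p D mk := by exact_mod_cast hRl
  have hR0 : (0 : ℤ) ≤ (Rl : ℤ) := Nat.cast_nonneg _
  have hR : (0 : ℤ) ≤ (KS0.R'0 κ Φ t p D mk : ℤ) := Nat.cast_nonneg _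
  set q := (prFA κ Φ t p D (KS.gT mk gx κ Φ t p D) f).kFF₂ (fcellsA κ Φ t p D (KS.gT mk gx κ Φ t p D) f) Rl I
  set u := (if oth I = 0 then KS.u₀A κ Φ t p D (KS.gT mk gx κ Φ t p D) f else KS.u₁A κ Φ t p D (KS.gT mk gx κ Φ t p D) f)
  set r := ((fcellsA κ Φ t p D (KS.gT mk gx κ Φ t p D) f).r (oth I) : ℤ)
  linarith

end Band2

end NegB

end PlanarSkeletonFrmFrom

end Summit.CriticalPhenomena.PercolationContinuityZ3.Theorems.Transplant

end
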